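import Summits.QuantumFields.YangMills.Theorems.BalabanUVNodesN15CovariantLandauMinimizers
import Summits.QuantumFields.YangMills.Theorems.BalabanUVNodesN15BlockRowsMatrix
import Summits.QuantumFields.YangMills.Theorems.BalabanUVNodesN15BackgroundModel
import Literature.MathematicalPhysics.QuantumFieldTheory.Balaban1983to89.B6UnitTorusCarrier
import HarnessLib

/-!
# Route «BalabanUVNodes», node N15 = NE2, road (c) — PROGRAMME (P-S), III: THE GLOBAL ROW OF THE LANDAU PERTURBATION LETTER `N_V^R = D_U(I−R(U))D*_U − ∂(I−R(1))∂ᵀ`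
# FROM SUP-NORM ROWS OF THE PRIMITIVE PROPAGATOR FAMILY — `G′`, `D·G′`, `(Q′G′²Q′ᵀ)⁻¹` at the background and at `1`, the one covariant difference `D_TG′(T) − ∂G′(1)` and the
# difference `G′(T) − G′(1)` — on any fine torus `Tor (fine n M)`, uniformly in `n` (dag-n15-c g23, n15-c∕214)

Cell `pub-ymgap`, seat `pub-ymgap-dag-n15-c` (generation g23; R134 (a), s1; HUMAN RULING D-0062; chair R424 venue).  `bears_on: R4∕N15 · K3⁸ SpineGivenEndpointR13SepCoPHV
(stmt-QuantumFields-27366)`; filed `--supports stmt-QuantumFields-27366 --as helper` — COUNT-NEUTRAL.  One bookkeeping `def` (`landauLetterConst`, the explicit constant) + theorems;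
0 `sorry`; NO estimate of Bałaban's: the primitive rows are HYPOTHESES of the printed shapes.  Imports BY NAME n15-c∕212 `…CovariantLandauMinimizers` (`cM`, `cE`, `cM_sub`, `cE_sub`,
`cSop_sub_transpose`, `cSop_inv_sub'`, `landauCov_sub_factorised`, `cgrad_mul_cGreen_eq_add`), n15-c∕213 `…BlockRowsMatrix` (`hasMaj_mulVecLin_of_sum_abs_le`, `hasMaj_transpose_mul_exp`,
`hasMaj_mul_mul_transpose_exp`, `hasMaj_comp_localRight`), n15-c∕205 (`csavg_sub_apply`, `csavg_sub_cols_le`), n15-b `…N15BackgroundModel` (`kappa_ofBlocks`), `B6UnitTorusCarrier`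
(`unitTorusGeo`, `rowSum_unitTorusGeo`, `card_fibre_blockOf`, `card_fibre_fineBond`), `B11SectG` (`HasMaj.add∕neg∕of_rate_le`, `hasMaj_comp_exp`).  Nothing in the tree is modified.

WHY (HOME HANDOFF g22 «LOCATED NEXT OBJECT»; ref-J READ-500 A2 on n15-c∕211).  n15-c∕211 displays, for the Landau perturbation letter `N_V^R`, ONE sup-norm block row per grid.
[Balaban1985BackgroundPropagators] p. 399 obtains the kernel bounds (3.49) of `P = I − R`, `DP`, `PD*`, `DPD*` from Theorem 3.1 ((3.42): `|G′(U)λ|`, `|∇_UG′(U)λ|`) and Theorem 3.2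
((3.48): `|(Q′(U)G′²(U)Q′*(U))⁻¹(y,y′)|`) «using again Lemma 2.1»; Theorem 3.4 (p. 400) controls the dependence on the background.  THIS FILE performs that deduction in the model on the
factorised form of n15-c∕212: GIVEN sup-norm block rows for `G′`, `D·G′` at `T` and `1`, `(Q′G′²Q′ᵀ)⁻¹` at `T` and `1`, and for the differences `D_TG′(T) − ∂G′(1)`, `G′(T) − G′(1)` (sizes
`P_D`, `P_G`), the matrix `landauCov T a − landauCov 1 a` of `N_V^R` has the block row `R·e^{−(δ/2)|y−y′|_T}`, `R = landauLetterConst …` EXPLICIT, every monomial carrying `P_D`, `P_G` or the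
staircase letter `σ`, and NO power of `n` (the `n^{±(d+1)}` of `Q′ᵀ`, `(Q′G′²Q′ᵀ)⁻¹` and of the block cardinalities cancel).
RESULTS (`BS`∕`BV`∕`BC` = sharp block norms of coloured fine scalars ∕ fine 1-forms ∕ coarse scalars over `unitTorusGeo L k M`; `1` = the flat datum `fun _ _ => 1`): §1 block cardinalities,
`mulVecLin_neg'`; §2 LOCAL rows `hasMaj_csavg_transpose` (`Q′(T)ᵀ`: `𝟙[y = y′]·n^{−(d+1)}τ`), `hasMaj_csavg_sub_transpose` (`𝟙·n^{−(d+1)}σ`); §3 `hasMaj_cM_of`, `hasMaj_cE_of`,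
`hasMaj_cM_sub_of`, `hasMaj_cE_sub_of`, `hasMaj_cSop_sub_of` (`S(T) − S(1) = (δM)ᵀM + Mᵀ(δM)`), `hasMaj_cSop_inv_sub_of`; §4 `landauLetterConst`, ★★★ **`hasMaj_landauCov_sub`** — THE GLOBAL
ROW of `landauCov T a − landauCov 1 a` on `BV` (n15-c∕211's `hG1`∕`hG2` shape on the generic torus; both grids of the knit are instances).

HONEST FRAMING ∕ LIMITS.  Bookkeeping of block majorants; the NINE primitive rows are HYPOTHESES (Thm 3.1 (3.42) value∕gradient members at `U` and `1` = [Balaban1984PropagatorsII] Prop. 2.2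
at `1`; Thm 3.2 (3.48) at `U` and `1`; Thm 3.4's perturbation rows) — NOT proved here; the sequel n15-c∕215 derives the rows AT `T` (`G′(T)`, `(Q′G′²Q′ᵀ)⁻¹(T)`, `G′(T) − G′(1)`) from the
flat ones + `D_TG′(T) − ∂G′(1)` by Neumann series.  MODEL READING as n15-c∕197 (one averaging level, whole torus, uniform weights, one-level staircases, site transporters); NOT
[Balaban1985BackgroundPropagators] Thms 3.1–3.4 as printed; NE2⁺ NOT PRINTED; N15 of record untouched (DISCHARGED AS CONSUMED, p687738); counts UNMOVED (typed 28∕28 · discharged 8∕27);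
one finite 𝕋⁴ at fixed ε per index — NOT infinite volume ∕ OS ∕ mass gap ∕ Clay.  Restate-immune (no Theses import).
-/

noncomputable section

open scoped BigOperators Matrix
open Finset

namespace Summit.QuantumFields.YangMills.BalabanUVNodes.N15.CovLandau

open Literature.MathematicalPhysics.QuantumFieldTheory.Balaban1983to89
open Literature.MathematicalPhysics.QuantumFieldTheory.Balaban1983to89.B5Prop11Plancherel (Tor fine)
open Literature.MathematicalPhysics.QuantumFieldTheory.Balaban1983to89.B11SectG (BlockNorm HasMaj RowSum hasMaj_comp_exp)
open Literature.MathematicalPhysics.QuantumFieldTheory.Balaban1983to89.B6UnitTorusCarrier (unitTorusGeo rowSum_unitTorusGeo triangle254_unitTorusGeo unitTorusGeo_dist_nonneg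
  unitTorusGeo_dist_symm unitTorusGeo_dist_self card_fibre_blockOf card_fibre_fineBond)
open Literature.MathematicalPhysics.QuantumFieldTheory.Balaban1983to89.T4EtaRateCoeffDefect (fibre mem_fibre)
open Literature.MathematicalPhysics.QuantumFieldTheory.King1986.Torus (blockOf tdistT)
open Summit.QuantumFields.YangMills.BalabanUVNodes.N15.VectorPiece (blockCoords)
open Summit.QuantumFields.YangMills.BalabanUVNodes.N15.MatrixSpecies (liftBlk)
open Summit.QuantumFields.YangMills.BalabanUVNodes.N15.CovAvg (cvaStair cvaStair_one)
open Summit.QuantumFields.YangMills.BalabanUVNodes.N15.BackgroundModel (kappa_ofBlocks)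
open Summit.QuantumFields.YangMills.BalabanUVNodes.N15.BlockRows (hasMaj_mulVecLin_of_sum_abs_le hasMaj_transpose_mul_exp hasMaj_mul_mul_transpose_exp hasMaj_comp_localRight)

variable {d : ℕ}

/-! ## §1 Block cardinalities of the coloured carriers; `mulVecLin` of differences -/

section Cards

omit d in
/-- The fibres of a colour-lifted block map are the fibres of the block map times the colours. [folklore] -/
theorem card_fibre_liftBlk {X S : Type} [Fintype X] [DecidableEq S] (blk : X → S) (ι : Type) [Fintype ι] (w : S) :
    (fibre (liftBlk blk ι) w).card = (fibre blk w).card * Fintype.card ι := by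
  classical
  have h : fibre (liftBlk blk ι) w = (fibre blk w) ×ˢ (Finset.univ : Finset ι) := by
    ext ⟨x, i⟩
    simp only [mem_fibre, Finset.mem_product, Finset.mem_univ, and_true]
  rw [h, Finset.card_product, Finset.card_univ]

variable (M : Fin (d + 1) → ℕ) [∀ μ, NeZero (M μ)] (n : ℕ) [NeZero n] (ι : Type) [Fintype ι]

/-- Coloured fine scalars over a unit block: `n^{d+1}·|ι|`. [folklore] -/
theorem card_fibre_blkS (w : Tor M) : (fibre (liftBlk (blockOf n M) ι) w).card = n ^ (d + 1) * Fintype.card ι := by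
  rw [card_fibre_liftBlk, card_fibre_blockOf]

/-- Coloured fine 1-forms over a unit block: `(d+1)·n^{d+1}·|ι|`. [folklore] -/
theorem card_fibre_blkV (w : Tor M) : (fibre (liftBlk (fun b : Tor (fine n M) × Fin (d + 1) => blockOf n M b.1) ι) w).card = (d + 1) * n ^ (d + 1) * Fintype.card ι := by
  rw [card_fibre_liftBlk, card_fibre_fineBond]

/-- Coloured coarse scalars over a coarse site: `|ι|`. [folklore] -/
theorem card_fibre_blkC (w : Tor M) : (fibre (liftBlk (fun y : Tor M => y) ι) w).card = Fintype.card ι := by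
  classical
  have : fibre (fun y : Tor M => y) w = {w} := by ext y; simp [mem_fibre]
  rw [card_fibre_liftBlk, this, Finset.card_singleton, one_mul]

end Cards

section LinAlg

omit d in
/-- `mulVecLin` of a negative. [folklore] -/
theorem mulVecLin_neg' {m k : Type} [Fintype k] (A : Matrix m k ℝ) : (-A).mulVecLin = -A.mulVecLin := by
  apply LinearMap.ext; intro v; simp

end LinAlg

/-! ## §2 The block-local rows of `Q′(T)ᵀ` and `(Q′(T) − Q′(1))ᵀ` -/

section Local

variable (M : Fin (d + 1) → ℕ) [∀ μ, NeZero (M μ)] (n : ℕ) [NeZero n] {ι : Type} [Fintype ι] [DecidableEq ι] (L k : ℕ)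

omit [DecidableEq ι] in
/-- A sum over the coloured coarse points of one coarse site is the sum over the colours. [folklore] -/
theorem sum_fibre_blkC (f : Tor M × ι → ℝ) (w : Tor M) : ∑ q ∈ fibre (liftBlk (fun y : Tor M => y) ι) w, f q = ∑ j, f (w, j) := by
  classical
  have h : fibre (liftBlk (fun y : Tor M => y) ι) w = (Finset.univ : Finset ι).map ⟨fun j => (w, j), fun a b hab => (Prod.mk.inj hab).2⟩ := by
    ext ⟨y, j⟩
    simp only [mem_fibre, Finset.mem_map, Finset.mem_univ, Function.Embedding.coeFn_mk, true_and, Prod.mk.injEq]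
    constructor
    · intro hy; exact ⟨j, hy.symm, rfl⟩
    · rintro ⟨j', rfl, rfl⟩; rfl
  rw [h, Finset.sum_map]; rfl

/-- ★ **THE ROW OF `Q′(T)ᵀ` (coarse → fine scalars) IS BLOCK-DIAGONAL**: `𝟙[y = y′]·n^{−(d+1)}·τ`, `τ` bounding the column sums of the staircase transports `T(Γ_{y,x})`.
[cite: Balaban1985BackgroundPropagators, (3.19) p.393 (shape of `Q′(U)`); Balaban1984PropagatorsI, (1.20) p.20] -/
theorem hasMaj_csavg_transpose (T : Fin (d + 1) → Tor (fine n M) → Matrix ι ι ℝ) {τ : ℝ} (hτ0 : 0 ≤ τ)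
    (hτ : ∀ y a i, ∑ j, |cvaStair M n (fun μ b => T μ b.1) y a 0 j i| ≤ τ) :
    HasMaj (BlockNorm.ofBlocks (unitTorusGeo L k M) (liftBlk (fun y : Tor M => y) ι)) (BlockNorm.ofBlocks (unitTorusGeo L k M) (liftBlk (blockOf n M) ι))
      (Matrix.mulVecLin (csavg M n T)ᵀ) (fun w w' => if w = w' then ((n : ℝ) ^ (d + 1))⁻¹ * τ else 0) := by
  have hn : (0 : ℝ) < (n : ℝ) ^ (d + 1) := pow_pos (Nat.cast_pos.mpr (Nat.pos_of_ne_zero (NeZero.ne n))) _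
  refine hasMaj_mulVecLin_of_sum_abs_le _ _ (fun w w' => by split_ifs <;> positivity) fun p w' => ?_
  rw [sum_fibre_blkC]
  change ∑ j, |(csavg M n T)ᵀ p (w', j)| ≤ if blockOf n M p.1 = w' then ((n : ℝ) ^ (d + 1))⁻¹ * τ else 0
  simp only [Matrix.transpose_apply, csavg]
  split_ifs with hw
  · calc ∑ j, |((n : ℝ) ^ (d + 1))⁻¹ * cvaStair M n (fun μ b => T μ b.1) w' (blockCoords n M p.1).2 0 j p.2|
        = ((n : ℝ) ^ (d + 1))⁻¹ * ∑ j, |cvaStair M n (fun μ b => T μ b.1) w' (blockCoords n M p.1).2 0 j p.2| := by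
          rw [Finset.mul_sum]; exact Finset.sum_congr rfl fun j _ => by rw [abs_mul, abs_inv, abs_pow, Nat.abs_cast]
      _ ≤ ((n : ℝ) ^ (d + 1))⁻¹ * τ := mul_le_mul_of_nonneg_left (hτ _ _ _) (inv_nonneg.mpr hn.le)
  · simp

/-- ★ **THE ROW OF `(Q′(T) − Q′(1))ᵀ`**: `𝟙[y = y′]·n^{−(d+1)}·σ`, `σ` = n15-c∕205's column letter of the staircase-transport difference `T(Γ) − 1`.
[cite: Balaban1985BackgroundPropagators, Thm 3.4 p.400 («small perturbations of the operators depending on U only»: mechanism)] -/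
theorem hasMaj_csavg_sub_transpose (T : Fin (d + 1) → Tor (fine n M) → Matrix ι ι ℝ) {σ : ℝ} (hσ0 : 0 ≤ σ)
    (hσ : ∀ y a j, ∑ i, |(cvaStair M n (fun μ b => T μ b.1) y a 0 - cvaStair M n (fun μ b => (fun (_ : Fin (d + 1)) (_ : Tor (fine n M)) => (1 : Matrix ι ι ℝ)) μ b.1) y a 0) i j| ≤ σ) :
    HasMaj (BlockNorm.ofBlocks (unitTorusGeo L k M) (liftBlk (fun y : Tor M => y) ι)) (BlockNorm.ofBlocks (unitTorusGeo L k M) (liftBlk (blockOf n M) ι))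
      (Matrix.mulVecLin (csavg M n T - csavg M n (fun (_ : Fin (d + 1)) (_ : Tor (fine n M)) => (1 : Matrix ι ι ℝ)))ᵀ)
      (fun w w' => if w = w' then ((n : ℝ) ^ (d + 1))⁻¹ * σ else 0) := by
  have hn : (0 : ℝ) < (n : ℝ) ^ (d + 1) := pow_pos (Nat.cast_pos.mpr (Nat.pos_of_ne_zero (NeZero.ne n))) _
  refine hasMaj_mulVecLin_of_sum_abs_le _ _ (fun w w' => by split_ifs <;> positivity) fun p w' => ?_
  change ∑ q ∈ fibre (liftBlk (fun y : Tor M => y) ι) w', |(csavg M n T - csavg M n (fun (_ : Fin (d + 1)) (_ : Tor (fine n M)) => (1 : Matrix ι ι ℝ)))ᵀ p q| ≤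
    if blockOf n M p.1 = w' then ((n : ℝ) ^ (d + 1))⁻¹ * σ else 0
  simp only [Matrix.transpose_apply]
  split_ifs with hw
  · -- the block sum is at most the full column sum of n15-c∕205
    calc ∑ q ∈ fibre (liftBlk (fun y : Tor M => y) ι) w', |(csavg M n T - csavg M n (fun (_ : Fin (d + 1)) (_ : Tor (fine n M)) => (1 : Matrix ι ι ℝ))) q p|
        ≤ ∑ q, |(csavg M n T - csavg M n (fun (_ : Fin (d + 1)) (_ : Tor (fine n M)) => (1 : Matrix ι ι ℝ))) q p| := Finset.sum_le_univ_sum_of_nonneg fun q => abs_nonneg _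
      _ ≤ ((n : ℝ) ^ (d + 1))⁻¹ * σ := csavg_sub_cols_le M n (T := T) (T' := fun (_ : Fin (d + 1)) (_ : Tor (fine n M)) => (1 : Matrix ι ι ℝ)) hσ p
  · refine le_of_eq (Finset.sum_eq_zero fun q hq => ?_)
    have hq1 : q.1 = w' := (mem_fibre _ _ _).1 hq
    rw [csavg_sub_apply]
    have : ¬ blockOf n M p.1 = q.1 := fun h => hw (h.trans hq1)
    simp [this]

end Local

/-! ## §3 Composite rows: `M`, `E`, their differences, `S(T) − S(1)`, `S(T)⁻¹ − S(1)⁻¹` -/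

section Composite

variable (M : Fin (d + 1) → ℕ) [∀ μ, NeZero (M μ)] (n : ℕ) [NeZero n] {ι : Type} [Fintype ι] [DecidableEq ι] (L k : ℕ)

/-- `M(T) = G′(T)·Q′(T)ᵀ` has the row `C·n^{−(d+1)}·τ·e^{−δd}` (BC → BS) from the row `C·e^{−δd}` of `G′(T)`. [cite: Balaban1985BackgroundPropagators, Thm 3.1 (3.42) p.397 (shape), (3.25) p.394] -/
theorem hasMaj_cM_of {T : Fin (d + 1) → Tor (fine n M) → Matrix ι ι ℝ} {a C δ τ : ℝ} (hC : 0 ≤ C) (hτ0 : 0 ≤ τ)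
    (hτ : ∀ y a' i, ∑ j, |cvaStair M n (fun μ b => T μ b.1) y a' 0 j i| ≤ τ)
    (hG : HasMaj (BlockNorm.ofBlocks (unitTorusGeo L k M) (liftBlk (blockOf n M) ι)) (BlockNorm.ofBlocks (unitTorusGeo L k M) (liftBlk (blockOf n M) ι))
      (Matrix.mulVecLin (cGreen M n T a)) (fun y y' => C * Real.exp (-(δ * tdistT M y y')))) :
    HasMaj (BlockNorm.ofBlocks (unitTorusGeo L k M) (liftBlk (fun y : Tor M => y) ι)) (BlockNorm.ofBlocks (unitTorusGeo L k M) (liftBlk (blockOf n M) ι))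
      (Matrix.mulVecLin (cM M n T a)) (fun y y' => C * ((n : ℝ) ^ (d + 1))⁻¹ * τ * Real.exp (-(δ * tdistT M y y'))) := by
  rw [cM, Matrix.mulVecLin_mul]
  refine (hasMaj_comp_localRight hG (hasMaj_csavg_transpose M n L k T hτ0 hτ) fun y y' => by positivity).mono fun y y' => le_of_eq ?_
  rw [kappa_ofBlocks]
  ring

/-- `E(T) = (D_TG′(T))·Q′(T)ᵀ` has the row `C_D·n^{−(d+1)}·τ·e^{−δd}` (BC → BV) from the gradient row of `D_TG′(T)`. [cite: Balaban1985BackgroundPropagators, Thm 3.1 (3.42) p.397 (shape), (3.49) p.399] -/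
theorem hasMaj_cE_of {T : Fin (d + 1) → Tor (fine n M) → Matrix ι ι ℝ} {a C δ τ : ℝ} (hC : 0 ≤ C) (hτ0 : 0 ≤ τ)
    (hτ : ∀ y a' i, ∑ j, |cvaStair M n (fun μ b => T μ b.1) y a' 0 j i| ≤ τ)
    (hD : HasMaj (BlockNorm.ofBlocks (unitTorusGeo L k M) (liftBlk (blockOf n M) ι)) (BlockNorm.ofBlocks (unitTorusGeo L k M) (liftBlk (fun b : Tor (fine n M) × Fin (d + 1) => blockOf n M b.1) ι))
      (Matrix.mulVecLin (cgrad M n T * cGreen M n T a)) (fun y y' => C * Real.exp (-(δ * tdistT M y y')))) :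
    HasMaj (BlockNorm.ofBlocks (unitTorusGeo L k M) (liftBlk (fun y : Tor M => y) ι)) (BlockNorm.ofBlocks (unitTorusGeo L k M) (liftBlk (fun b : Tor (fine n M) × Fin (d + 1) => blockOf n M b.1) ι))
      (Matrix.mulVecLin (cE M n T a)) (fun y y' => C * ((n : ℝ) ^ (d + 1))⁻¹ * τ * Real.exp (-(δ * tdistT M y y'))) := by
  rw [cE, Matrix.mulVecLin_mul]
  refine (hasMaj_comp_localRight hD (hasMaj_csavg_transpose M n L k T hτ0 hτ) fun y y' => by positivity).mono fun y y' => le_of_eq ?_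
  rw [kappa_ofBlocks]
  ring

/-- `M(T) − M(1) = (G′(T) − G′(1))Q′(T)ᵀ + G′(1)(Q′(T) − Q′(1))ᵀ` has the row `(P_G·τ + C·σ)·n^{−(d+1)}·e^{−δd}`. [cite: Balaban1985BackgroundPropagators, Thm 3.4 p.400 (mechanism)] -/
theorem hasMaj_cM_sub_of {T : Fin (d + 1) → Tor (fine n M) → Matrix ι ι ℝ} {a C PG δ τ σ : ℝ} (hC : 0 ≤ C) (hPG : 0 ≤ PG) (hτ0 : 0 ≤ τ) (hσ0 : 0 ≤ σ)
    (hτ : ∀ y a' i, ∑ j, |cvaStair M n (fun μ b => T μ b.1) y a' 0 j i| ≤ τ)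
    (hσ : ∀ y a' j, ∑ i, |(cvaStair M n (fun μ b => T μ b.1) y a' 0 - cvaStair M n (fun μ b => (fun (_ : Fin (d + 1)) (_ : Tor (fine n M)) => (1 : Matrix ι ι ℝ)) μ b.1) y a' 0) i j| ≤ σ)
    (hG1 : HasMaj (BlockNorm.ofBlocks (unitTorusGeo L k M) (liftBlk (blockOf n M) ι)) (BlockNorm.ofBlocks (unitTorusGeo L k M) (liftBlk (blockOf n M) ι))
      (Matrix.mulVecLin (cGreen M n (fun (_ : Fin (d + 1)) (_ : Tor (fine n M)) => (1 : Matrix ι ι ℝ)) a)) (fun y y' => C * Real.exp (-(δ * tdistT M y y'))))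
    (hδG : HasMaj (BlockNorm.ofBlocks (unitTorusGeo L k M) (liftBlk (blockOf n M) ι)) (BlockNorm.ofBlocks (unitTorusGeo L k M) (liftBlk (blockOf n M) ι))
      (Matrix.mulVecLin (cGreen M n T a - cGreen M n (fun (_ : Fin (d + 1)) (_ : Tor (fine n M)) => (1 : Matrix ι ι ℝ)) a)) (fun y y' => PG * Real.exp (-(δ * tdistT M y y')))) :
    HasMaj (BlockNorm.ofBlocks (unitTorusGeo L k M) (liftBlk (fun y : Tor M => y) ι)) (BlockNorm.ofBlocks (unitTorusGeo L k M) (liftBlk (blockOf n M) ι))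
      (Matrix.mulVecLin (cM M n T a - cM M n (fun (_ : Fin (d + 1)) (_ : Tor (fine n M)) => (1 : Matrix ι ι ℝ)) a))
      (fun y y' => (PG * τ + C * σ) * ((n : ℝ) ^ (d + 1))⁻¹ * Real.exp (-(δ * tdistT M y y'))) := by
  rw [cM_sub, Matrix.mulVecLin_add, Matrix.mulVecLin_mul, Matrix.mulVecLin_mul]
  have h1 := hasMaj_comp_localRight hδG (hasMaj_csavg_transpose M n L k T hτ0 hτ) fun y y' => by positivity
  have h2 := hasMaj_comp_localRight hG1 (hasMaj_csavg_sub_transpose M n L k T hσ0 hσ) fun y y' => by positivity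
  refine (h1.add h2).mono fun y y' => le_of_eq ?_
  rw [kappa_ofBlocks]
  ring

/-- `E(T) − E(1) = (D_TG′(T) − ∂G′(1))Q′(T)ᵀ + ∂G′(1)(Q′(T) − Q′(1))ᵀ` has the row `(P_D·τ + C_D·σ)·n^{−(d+1)}·e^{−δd}`. [cite: Balaban1985BackgroundPropagators, Thm 3.4 p.400 (mechanism), (3.49) p.399] -/
theorem hasMaj_cE_sub_of {T : Fin (d + 1) → Tor (fine n M) → Matrix ι ι ℝ} {a CD PD δ τ σ : ℝ} (hCD : 0 ≤ CD) (hPD : 0 ≤ PD) (hτ0 : 0 ≤ τ) (hσ0 : 0 ≤ σ)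
    (hτ : ∀ y a' i, ∑ j, |cvaStair M n (fun μ b => T μ b.1) y a' 0 j i| ≤ τ)
    (hσ : ∀ y a' j, ∑ i, |(cvaStair M n (fun μ b => T μ b.1) y a' 0 - cvaStair M n (fun μ b => (fun (_ : Fin (d + 1)) (_ : Tor (fine n M)) => (1 : Matrix ι ι ℝ)) μ b.1) y a' 0) i j| ≤ σ)
    (hD1 : HasMaj (BlockNorm.ofBlocks (unitTorusGeo L k M) (liftBlk (blockOf n M) ι)) (BlockNorm.ofBlocks (unitTorusGeo L k M) (liftBlk (fun b : Tor (fine n M) × Fin (d + 1) => blockOf n M b.1) ι))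
      (Matrix.mulVecLin (cgrad M n (fun (_ : Fin (d + 1)) (_ : Tor (fine n M)) => (1 : Matrix ι ι ℝ)) * cGreen M n (fun (_ : Fin (d + 1)) (_ : Tor (fine n M)) => (1 : Matrix ι ι ℝ)) a))
      (fun y y' => CD * Real.exp (-(δ * tdistT M y y'))))
    (hδD : HasMaj (BlockNorm.ofBlocks (unitTorusGeo L k M) (liftBlk (blockOf n M) ι)) (BlockNorm.ofBlocks (unitTorusGeo L k M) (liftBlk (fun b : Tor (fine n M) × Fin (d + 1) => blockOf n M b.1) ι))
      (Matrix.mulVecLin (cgrad M n T * cGreen M n T a - cgrad M n (fun (_ : Fin (d + 1)) (_ : Tor (fine n M)) => (1 : Matrix ι ι ℝ)) * cGreen M n (fun (_ : Fin (d + 1)) (_ : Tor (fine n M)) => (1 : Matrix ι ι ℝ)) a))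
      (fun y y' => PD * Real.exp (-(δ * tdistT M y y')))) :
    HasMaj (BlockNorm.ofBlocks (unitTorusGeo L k M) (liftBlk (fun y : Tor M => y) ι)) (BlockNorm.ofBlocks (unitTorusGeo L k M) (liftBlk (fun b : Tor (fine n M) × Fin (d + 1) => blockOf n M b.1) ι))
      (Matrix.mulVecLin (cE M n T a - cE M n (fun (_ : Fin (d + 1)) (_ : Tor (fine n M)) => (1 : Matrix ι ι ℝ)) a))
      (fun y y' => (PD * τ + CD * σ) * ((n : ℝ) ^ (d + 1))⁻¹ * Real.exp (-(δ * tdistT M y y'))) := by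
  rw [cE_sub, Matrix.mulVecLin_add, Matrix.mulVecLin_mul, Matrix.mulVecLin_mul]
  have h1 := hasMaj_comp_localRight hδD (hasMaj_csavg_transpose M n L k T hτ0 hτ) fun y y' => by positivity
  have h2 := hasMaj_comp_localRight hD1 (hasMaj_csavg_sub_transpose M n L k T hσ0 hσ) fun y y' => by positivity
  refine (h1.add h2).mono fun y y' => le_of_eq ?_
  rw [kappa_ofBlocks]
  ring

/-- ★ `S(T) − S(1) = (δM)ᵀ·M(T) + M(1)ᵀ·δM` has the coarse row `|ι|·c·C·(τ + 1)·(P_Gτ + Cσ)·n^{−(d+1)}·e^{−(δ−s)d}` — the transposed factor pairs with whole fine blocks (`n^{d+1}|ι|` points), one row sum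
(2.61) at the margin `s`. [cite: Balaban1985BackgroundPropagators, Thm 3.2 (3.48) p.398 (the object), Thm 3.4 p.400 (perturbation); Balaban1984PropagatorsII, Lemma 2.1 (2.61) p.234] -/
theorem hasMaj_cSop_sub_of {T : Fin (d + 1) → Tor (fine n M) → Matrix ι ι ℝ} {a C PG δ s cs τ σ : ℝ} (hC : 0 ≤ C) (hPG : 0 ≤ PG) (hτ0 : 0 ≤ τ) (hσ0 : 0 ≤ σ)
    (hs : 0 < s) (hsδ : s ≤ δ) (hrow : RowSum (unitTorusGeo L k M) s cs)
    (hMT : HasMaj (BlockNorm.ofBlocks (unitTorusGeo L k M) (liftBlk (fun y : Tor M => y) ι)) (BlockNorm.ofBlocks (unitTorusGeo L k M) (liftBlk (blockOf n M) ι))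
      (Matrix.mulVecLin (cM M n T a)) (fun y y' => C * ((n : ℝ) ^ (d + 1))⁻¹ * τ * Real.exp (-(δ * tdistT M y y'))))
    (hM1 : HasMaj (BlockNorm.ofBlocks (unitTorusGeo L k M) (liftBlk (fun y : Tor M => y) ι)) (BlockNorm.ofBlocks (unitTorusGeo L k M) (liftBlk (blockOf n M) ι))
      (Matrix.mulVecLin (cM M n (fun (_ : Fin (d + 1)) (_ : Tor (fine n M)) => (1 : Matrix ι ι ℝ)) a)) (fun y y' => C * ((n : ℝ) ^ (d + 1))⁻¹ * 1 * Real.exp (-(δ * tdistT M y y'))))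
    (hδM : HasMaj (BlockNorm.ofBlocks (unitTorusGeo L k M) (liftBlk (fun y : Tor M => y) ι)) (BlockNorm.ofBlocks (unitTorusGeo L k M) (liftBlk (blockOf n M) ι))
      (Matrix.mulVecLin (cM M n T a - cM M n (fun (_ : Fin (d + 1)) (_ : Tor (fine n M)) => (1 : Matrix ι ι ℝ)) a))
      (fun y y' => (PG * τ + C * σ) * ((n : ℝ) ^ (d + 1))⁻¹ * Real.exp (-(δ * tdistT M y y')))) :
    HasMaj (BlockNorm.ofBlocks (unitTorusGeo L k M) (liftBlk (fun y : Tor M => y) ι)) (BlockNorm.ofBlocks (unitTorusGeo L k M) (liftBlk (fun y : Tor M => y) ι))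
      (Matrix.mulVecLin (cSop M n T a - cSop M n (fun (_ : Fin (d + 1)) (_ : Tor (fine n M)) => (1 : Matrix ι ι ℝ)) a))
      (fun y y' => (Fintype.card ι * cs * C * (τ + 1) * (PG * τ + C * σ)) * ((n : ℝ) ^ (d + 1))⁻¹ * Real.exp (-((δ - s) * tdistT M y y'))) := by
  have hn : (0 : ℝ) < (n : ℝ) ^ (d + 1) := pow_pos (Nat.cast_pos.mpr (Nat.pos_of_ne_zero (NeZero.ne n))) _
  have hNS : ∀ z : Tor M, (fibre (liftBlk (blockOf n M) ι) z).card ≤ n ^ (d + 1) * Fintype.card ι := fun z => (card_fibre_blkS M n ι z).le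
  rw [cSop_sub_transpose, Matrix.mulVecLin_add]
  have hA := hasMaj_transpose_mul_exp (g := unitTorusGeo L k M) (liftBlk (blockOf n M) ι) (liftBlk (fun y : Tor M => y) ι)
    (triangle254_unitTorusGeo L k M) (unitTorusGeo_dist_nonneg L k M) (unitTorusGeo_dist_symm L k M) hrow hs hsδ (by positivity) (by positivity) hNS hδM hMT
  have hB := hasMaj_transpose_mul_exp (g := unitTorusGeo L k M) (liftBlk (blockOf n M) ι) (liftBlk (fun y : Tor M => y) ι)
    (triangle254_unitTorusGeo L k M) (unitTorusGeo_dist_nonneg L k M) (unitTorusGeo_dist_symm L k M) hrow hs hsδ (by positivity) (by positivity) hNS hM1 hδM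
  refine (hA.add hB).mono fun y y' => le_of_eq ?_
  change ((n ^ (d + 1) * Fintype.card ι : ℕ) : ℝ) * ((PG * τ + C * σ) * ((n : ℝ) ^ (d + 1))⁻¹) * (C * ((n : ℝ) ^ (d + 1))⁻¹ * τ) * cs * Real.exp (-((δ - s) * tdistT M y y')) +
      ((n ^ (d + 1) * Fintype.card ι : ℕ) : ℝ) * (C * ((n : ℝ) ^ (d + 1))⁻¹ * 1) * ((PG * τ + C * σ) * ((n : ℝ) ^ (d + 1))⁻¹) * cs * Real.exp (-((δ - s) * tdistT M y y')) = _
  push_cast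
  field_simp

/-- ★ `S(T)⁻¹ − S(1)⁻¹ = −S(1)⁻¹·(S(T) − S(1))·S(T)⁻¹` has the coarse row `C_S²·cs²·[δS letter]·n^{d+1}·e^{−(δ−2s)d}` from the rows `C_S·n^{d+1}·e^{−δd}` of the two inverses and the row of
`S(T) − S(1)` at rate `δ − s`. [cite: Balaban1985BackgroundPropagators, Thm 3.2 (3.48) p.398, Thm 3.4 p.400 (the operator `(Q′(U)G′²(U)Q′*(U))⁻¹` among the perturbed ones); Balaban1984PropagatorsII, (2.52)–(2.56) pp.232–233] -/
theorem hasMaj_cSop_inv_sub_of {T : Fin (d + 1) → Tor (fine n M) → Matrix ι ι ℝ} (hT : ∀ ν x, IsUnit (T ν x)) {a : ℝ} (ha : 0 < a) {CS B δ s cs : ℝ} (hCS : 0 ≤ CS) (hB : 0 ≤ B) (hcs : 0 ≤ cs)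
    (hs : 0 < s) (hsδ : 2 * s ≤ δ) (hrow : RowSum (unitTorusGeo L k M) s cs)
    (hST : HasMaj (BlockNorm.ofBlocks (unitTorusGeo L k M) (liftBlk (fun y : Tor M => y) ι)) (BlockNorm.ofBlocks (unitTorusGeo L k M) (liftBlk (fun y : Tor M => y) ι))
      (Matrix.mulVecLin (cSop M n T a)⁻¹) (fun y y' => CS * (n : ℝ) ^ (d + 1) * Real.exp (-(δ * tdistT M y y'))))
    (hS1 : HasMaj (BlockNorm.ofBlocks (unitTorusGeo L k M) (liftBlk (fun y : Tor M => y) ι)) (BlockNorm.ofBlocks (unitTorusGeo L k M) (liftBlk (fun y : Tor M => y) ι))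
      (Matrix.mulVecLin (cSop M n (fun (_ : Fin (d + 1)) (_ : Tor (fine n M)) => (1 : Matrix ι ι ℝ)) a)⁻¹) (fun y y' => CS * (n : ℝ) ^ (d + 1) * Real.exp (-(δ * tdistT M y y'))))
    (hδS : HasMaj (BlockNorm.ofBlocks (unitTorusGeo L k M) (liftBlk (fun y : Tor M => y) ι)) (BlockNorm.ofBlocks (unitTorusGeo L k M) (liftBlk (fun y : Tor M => y) ι))
      (Matrix.mulVecLin (cSop M n T a - cSop M n (fun (_ : Fin (d + 1)) (_ : Tor (fine n M)) => (1 : Matrix ι ι ℝ)) a))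
      (fun y y' => B * ((n : ℝ) ^ (d + 1))⁻¹ * Real.exp (-((δ - s) * tdistT M y y')))) :
    HasMaj (BlockNorm.ofBlocks (unitTorusGeo L k M) (liftBlk (fun y : Tor M => y) ι)) (BlockNorm.ofBlocks (unitTorusGeo L k M) (liftBlk (fun y : Tor M => y) ι))
      (Matrix.mulVecLin ((cSop M n T a)⁻¹ - (cSop M n (fun (_ : Fin (d + 1)) (_ : Tor (fine n M)) => (1 : Matrix ι ι ℝ)) a)⁻¹))
      (fun y y' => (CS * CS * cs * cs * B) * (n : ℝ) ^ (d + 1) * Real.exp (-((δ - 2 * s) * tdistT M y y'))) := by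
  have hn : (0 : ℝ) < (n : ℝ) ^ (d + 1) := pow_pos (Nat.cast_pos.mpr (Nat.pos_of_ne_zero (NeZero.ne n))) _
  have h1 : ∀ (ν : Fin (d + 1)) (x : Tor (fine n M)), IsUnit ((fun (_ : Fin (d + 1)) (_ : Tor (fine n M)) => (1 : Matrix ι ι ℝ)) ν x) := fun _ _ => isUnit_one
  rw [cSop_inv_sub' M n hT h1 ha, mulVecLin_neg', Matrix.mulVecLin_mul, Matrix.mulVecLin_mul]
  -- inner composition `(δS)·S(T)⁻¹` at rate `δ − 2s`, outer `S(1)⁻¹·(…)` at rate `δ − 2s`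
  have hinner := hasMaj_comp_exp (b₂ := BlockNorm.ofBlocks (unitTorusGeo L k M) (liftBlk (fun y : Tor M => y) ι)) (ρ := δ - 2 * s)
    (triangle254_unitTorusGeo L k M) (unitTorusGeo_dist_nonneg L k M) hrow (by positivity) (by positivity) (by linarith) (by linarith) (by linarith) hδS hST
  have houter := hasMaj_comp_exp (b₂ := BlockNorm.ofBlocks (unitTorusGeo L k M) (liftBlk (fun y : Tor M => y) ι)) (ρ := δ - 2 * s)
    (triangle254_unitTorusGeo L k M) (unitTorusGeo_dist_nonneg L k M) hrow (by positivity) (by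
      rw [kappa_ofBlocks]; positivity) (by linarith) le_rfl (by linarith) hS1 hinner
  refine houter.neg.mono fun y y' => le_of_eq ?_
  rw [kappa_ofBlocks]
  field_simp

end Composite

/-! ## §4 The global row of the Landau perturbation letter -/

section Letter

/-- THE EXPLICIT CONSTANT of the global row of `N_V^R` (no power of the fineness `n`): with `e_δ = P_Dτ + C_Dσ` (the `E`-difference letter), `e_T = (C_D + P_D)τ` (the `E(T)` letter),
`m_δ = P_Gτ + C_Gσ` (the `M`-difference letter): `R = (d+1)|ι|³cs²C_S·[e_δe_T + C_De_δ + |ι|cs³C_SC_G(τ+1)C_De_Tm_δ]` — every monomial carries `P_D`, `P_G` or `σ`. [folklore] -/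
def landauLetterConst (D I cs CS CG CD PD PG τ σ : ℝ) : ℝ :=
  D * I ^ 3 * cs ^ 2 * CS * ((PD * τ + CD * σ) * ((CD + PD) * τ) + CD * (PD * τ + CD * σ) + I * cs ^ 3 * CS * CG * (τ + 1) * CD * ((CD + PD) * τ) * (PG * τ + CG * σ))

omit d in
/-- `R ≥ 0` for non-negative letters. [folklore] -/
theorem landauLetterConst_nonneg {D I cs CS CG CD PD PG τ σ : ℝ} (hD : 0 ≤ D) (hI : 0 ≤ I) (hcs : 0 ≤ cs) (hCS : 0 ≤ CS) (hCG : 0 ≤ CG) (hCD : 0 ≤ CD) (hPD : 0 ≤ PD)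
    (hPG : 0 ≤ PG) (hτ : 0 ≤ τ) (hσ : 0 ≤ σ) : 0 ≤ landauLetterConst D I cs CS CG CD PD PG τ σ := by
  unfold landauLetterConst; positivity

variable (M : Fin (d + 1) → ℕ) [∀ μ, NeZero (M μ)] (n : ℕ) [NeZero n] {ι : Type} [Fintype ι] [DecidableEq ι] (L k : ℕ)
set_option maxHeartbeats 400000 in
/-- ★★★ **THE GLOBAL ROW OF THE LANDAU PERTURBATION LETTER FROM THE PRIMITIVE PROPAGATOR ROWS.**  On the fine torus `Tor (fine n M)` with King's unit blocks, let the transporter datum `T`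
(invertible) have staircase transports with column sums `≤ τ` and staircase-difference letter `σ` (n15-c∕205), and suppose the sup-norm block rows, all at one rate `δ > 0`:
`G′(1)`, `G′(T)` ≤ `C_G e^{−δd}` (BS → BS), `∂G′(1)` ≤ `C_D e^{−δd}` (BS → BV), `D_TG′(T) − ∂G′(1)` ≤ `P_D e^{−δd}`, `G′(T) − G′(1)` ≤ `P_G e^{−δd}`, `(Q′G′²Q′ᵀ)⁻¹` at `T` and at `1` ≤
`C_S n^{d+1} e^{−δd}` (BC → BC).  THEN `landauCov T a − landauCov 1 a` — the matrix of `N_V^R` — has the block row `R·e^{−(δ/2)d}` on coloured fine 1-forms with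
`R = landauLetterConst (d+1) |ι| cs C_S C_G C_D P_D P_G τ σ`, `cs` = the row-sum constant (2.61) at rate `δ/8`.  The deduction of [B9] p. 399 ((3.49) from Thms 3.1–3.2) and of Thm 3.4's
perturbation statement, in the model; the rows are hypotheses.
[cite: Balaban1985BackgroundPropagators, (3.49) p.399, Thm 3.1 (3.42) p.397, Thm 3.2 (3.48) p.398, Thm 3.4 p.400; Balaban1984PropagatorsII, (2.52)–(2.56) pp.232–233, Lemma 2.1 (2.61) p.234] -/
theorem hasMaj_landauCov_sub {T : Fin (d + 1) → Tor (fine n M) → Matrix ι ι ℝ} (hT : ∀ ν x, IsUnit (T ν x)) {a : ℝ} (ha : 0 < a)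
    {δ CG CS CD PD PG τ σ : ℝ} (hδ : 0 < δ) (hCG : 0 ≤ CG) (hCS : 0 ≤ CS) (hCD : 0 ≤ CD) (hPD : 0 ≤ PD) (hPG : 0 ≤ PG) (hτ0 : 0 ≤ τ) (hσ0 : 0 ≤ σ)
    (hτ : ∀ y a' i, ∑ j, |cvaStair M n (fun μ b => T μ b.1) y a' 0 j i| ≤ τ)
    (hσ : ∀ y a' j, ∑ i, |(cvaStair M n (fun μ b => T μ b.1) y a' 0 - cvaStair M n (fun μ b => (fun (_ : Fin (d + 1)) (_ : Tor (fine n M)) => (1 : Matrix ι ι ℝ)) μ b.1) y a' 0) i j| ≤ σ)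
    (hG1 : HasMaj (BlockNorm.ofBlocks (unitTorusGeo L k M) (liftBlk (blockOf n M) ι)) (BlockNorm.ofBlocks (unitTorusGeo L k M) (liftBlk (blockOf n M) ι))
      (Matrix.mulVecLin (cGreen M n (fun (_ : Fin (d + 1)) (_ : Tor (fine n M)) => (1 : Matrix ι ι ℝ)) a)) (fun y y' => CG * Real.exp (-(δ * tdistT M y y'))))
    (hGT : HasMaj (BlockNorm.ofBlocks (unitTorusGeo L k M) (liftBlk (blockOf n M) ι)) (BlockNorm.ofBlocks (unitTorusGeo L k M) (liftBlk (blockOf n M) ι))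
      (Matrix.mulVecLin (cGreen M n T a)) (fun y y' => CG * Real.exp (-(δ * tdistT M y y'))))
    (hD1 : HasMaj (BlockNorm.ofBlocks (unitTorusGeo L k M) (liftBlk (blockOf n M) ι)) (BlockNorm.ofBlocks (unitTorusGeo L k M) (liftBlk (fun b : Tor (fine n M) × Fin (d + 1) => blockOf n M b.1) ι))
      (Matrix.mulVecLin (cgrad M n (fun (_ : Fin (d + 1)) (_ : Tor (fine n M)) => (1 : Matrix ι ι ℝ)) * cGreen M n (fun (_ : Fin (d + 1)) (_ : Tor (fine n M)) => (1 : Matrix ι ι ℝ)) a))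
      (fun y y' => CD * Real.exp (-(δ * tdistT M y y'))))
    (hδD : HasMaj (BlockNorm.ofBlocks (unitTorusGeo L k M) (liftBlk (blockOf n M) ι)) (BlockNorm.ofBlocks (unitTorusGeo L k M) (liftBlk (fun b : Tor (fine n M) × Fin (d + 1) => blockOf n M b.1) ι))
      (Matrix.mulVecLin (cgrad M n T * cGreen M n T a - cgrad M n (fun (_ : Fin (d + 1)) (_ : Tor (fine n M)) => (1 : Matrix ι ι ℝ)) * cGreen M n (fun (_ : Fin (d + 1)) (_ : Tor (fine n M)) => (1 : Matrix ι ι ℝ)) a))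
      (fun y y' => PD * Real.exp (-(δ * tdistT M y y'))))
    (hδG : HasMaj (BlockNorm.ofBlocks (unitTorusGeo L k M) (liftBlk (blockOf n M) ι)) (BlockNorm.ofBlocks (unitTorusGeo L k M) (liftBlk (blockOf n M) ι))
      (Matrix.mulVecLin (cGreen M n T a - cGreen M n (fun (_ : Fin (d + 1)) (_ : Tor (fine n M)) => (1 : Matrix ι ι ℝ)) a)) (fun y y' => PG * Real.exp (-(δ * tdistT M y y'))))
    (hST : HasMaj (BlockNorm.ofBlocks (unitTorusGeo L k M) (liftBlk (fun y : Tor M => y) ι)) (BlockNorm.ofBlocks (unitTorusGeo L k M) (liftBlk (fun y : Tor M => y) ι))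
      (Matrix.mulVecLin (cSop M n T a)⁻¹) (fun y y' => CS * (n : ℝ) ^ (d + 1) * Real.exp (-(δ * tdistT M y y'))))
    (hS1 : HasMaj (BlockNorm.ofBlocks (unitTorusGeo L k M) (liftBlk (fun y : Tor M => y) ι)) (BlockNorm.ofBlocks (unitTorusGeo L k M) (liftBlk (fun y : Tor M => y) ι))
      (Matrix.mulVecLin (cSop M n (fun (_ : Fin (d + 1)) (_ : Tor (fine n M)) => (1 : Matrix ι ι ℝ)) a)⁻¹) (fun y y' => CS * (n : ℝ) ^ (d + 1) * Real.exp (-(δ * tdistT M y y')))) :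
    HasMaj (BlockNorm.ofBlocks (unitTorusGeo L k M) (liftBlk (fun b : Tor (fine n M) × Fin (d + 1) => blockOf n M b.1) ι))
      (BlockNorm.ofBlocks (unitTorusGeo L k M) (liftBlk (fun b : Tor (fine n M) × Fin (d + 1) => blockOf n M b.1) ι))
      (Matrix.mulVecLin (landauCov M n T a - landauCov M n (fun (_ : Fin (d + 1)) (_ : Tor (fine n M)) => (1 : Matrix ι ι ℝ)) a))
      (fun y y' => landauLetterConst (d + 1) (Fintype.card ι) (B4Sect5Proof.latticeConst (d + 1) (δ / 8)) CS CG CD PD PG τ σ * Real.exp (-(δ / 2 * tdistT M y y'))) := by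
  -- constants, geometry, row sum at the margin `s = δ/8`
  have hn : (0 : ℝ) < (n : ℝ) ^ (d + 1) := pow_pos (Nat.cast_pos.mpr (Nat.pos_of_ne_zero (NeZero.ne n))) _
  set s : ℝ := δ / 8 with hsdef
  have hs : 0 < s := by positivity
  set cs : ℝ := B4Sect5Proof.latticeConst (d + 1) s with hcsdef
  have hrow : RowSum (unitTorusGeo L k M) s cs := rowSum_unitTorusGeo L k M hs
  have hcs : 0 ≤ cs := B4Sect5Proof.latticeConst_nonneg (d + 1) hs.le
  have htri := triangle254_unitTorusGeo L k M
  have hd := unitTorusGeo_dist_nonneg L k M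
  have hsymm := unitTorusGeo_dist_symm L k M
  have hNV : ∀ z : Tor M, (fibre (liftBlk (fun b : Tor (fine n M) × Fin (d + 1) => blockOf n M b.1) ι) z).card ≤ (d + 1) * n ^ (d + 1) * Fintype.card ι :=
    fun z => (card_fibre_blkV M n ι z).le
  have hNC : ∀ w : Tor M, (fibre (liftBlk (fun y : Tor M => y) ι) w).card ≤ Fintype.card ι := fun w => (card_fibre_blkC M ι w).le
  have h1unit : ∀ (ν : Fin (d + 1)) (x : Tor (fine n M)), IsUnit ((fun (_ : Fin (d + 1)) (_ : Tor (fine n M)) => (1 : Matrix ι ι ℝ)) ν x) := fun _ _ => isUnit_one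
  -- the flat staircase transports are `1`: column sums `1`
  have hτ1 : ∀ (y : Tor M) (a' : Fin (d + 1) → Fin n) (i : ι), ∑ j, |cvaStair M n (fun μ b => (fun (_ : Fin (d + 1)) (_ : Tor (fine n M)) => (1 : Matrix ι ι ℝ)) μ b.1) y a' 0 j i| ≤ 1 := by
    intro y a' i
    have h : cvaStair M n (fun (μ : Fin (d + 1)) (b : Tor (fine n M) × Fin (d + 1)) => (1 : Matrix ι ι ℝ)) y a' 0 = 1 := cvaStair_one M n y a' 0
    have h1 : ∀ j : ι, |(1 : Matrix ι ι ℝ) j i| = if j = i then 1 else 0 := fun j => by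
      by_cases hj : j = i
      · subst hj; simp
      · simp [hj]
    change ∑ j, |(cvaStair M n (fun (μ : Fin (d + 1)) (b : Tor (fine n M) × Fin (d + 1)) => (1 : Matrix ι ι ℝ)) y a' 0) j i| ≤ 1
    rw [h]
    simp only [h1, Finset.sum_ite_eq', Finset.mem_univ, if_true, le_refl]
  -- the gradient row at `T`: flat + difference
  have hDT : HasMaj (BlockNorm.ofBlocks (unitTorusGeo L k M) (liftBlk (blockOf n M) ι)) (BlockNorm.ofBlocks (unitTorusGeo L k M) (liftBlk (fun b : Tor (fine n M) × Fin (d + 1) => blockOf n M b.1) ι))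
      (Matrix.mulVecLin (cgrad M n T * cGreen M n T a)) (fun y y' => (CD + PD) * Real.exp (-(δ * tdistT M y y'))) := by
    rw [cgrad_mul_cGreen_eq_add M n T (fun (_ : Fin (d + 1)) (_ : Tor (fine n M)) => (1 : Matrix ι ι ℝ)) a, Matrix.mulVecLin_add]
    exact (hD1.add hδD).mono fun y y' => le_of_eq (by ring)
  -- the minimizer rows
  have hMT := hasMaj_cM_of M n L k hCG hτ0 hτ hGT
  have hM1 := hasMaj_cM_of M n L k (T := fun (_ : Fin (d + 1)) (_ : Tor (fine n M)) => (1 : Matrix ι ι ℝ)) hCG zero_le_one hτ1 hG1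
  have hδM := hasMaj_cM_sub_of M n L k hCG hPG hτ0 hσ0 hτ hσ hG1 hδG
  have hET := hasMaj_cE_of M n L k (by positivity : 0 ≤ CD + PD) hτ0 hτ hDT
  have hE1 := hasMaj_cE_of M n L k (T := fun (_ : Fin (d + 1)) (_ : Tor (fine n M)) => (1 : Matrix ι ι ℝ)) hCD zero_le_one hτ1 hD1
  have hδE := hasMaj_cE_sub_of M n L k hCD hPD hτ0 hσ0 hτ hσ hD1 hδD
  -- the coarse inverse difference
  have hδS := hasMaj_cSop_sub_of M n L k hCG hPG hτ0 hσ0 hs (by linarith) hrow hMT hM1 hδM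
  have hδSinv := hasMaj_cSop_inv_sub_of M n L k hT ha hCS (by positivity) hcs hs (by linarith) hrow hST hS1 hδS
  -- lower every input of word 2 to the common rate `δ − 2s`
  have h2s : δ - 2 * s ≤ δ := by linarith
  have hE1'' := hE1.of_rate_le hd (by positivity) h2s
  have hET'' := hET.of_rate_le hd (by positivity) h2s
  -- the three words of `landauCov_sub_factorised`
  have hW1 := hasMaj_mul_mul_transpose_exp (g := unitTorusGeo L k M) (liftBlk (fun b : Tor (fine n M) × Fin (d + 1) => blockOf n M b.1) ι) (liftBlk (fun y : Tor M => y) ι)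
    htri hd hsymm hrow hs (by linarith : s ≤ δ) (by positivity) (by positivity) (by positivity) hNV hNC hδE hET hST
  have hW2 := hasMaj_mul_mul_transpose_exp (g := unitTorusGeo L k M) (liftBlk (fun b : Tor (fine n M) × Fin (d + 1) => blockOf n M b.1) ι) (liftBlk (fun y : Tor M => y) ι)
    htri hd hsymm hrow hs (by linarith : s ≤ δ - 2 * s) (by positivity) (by positivity) (by positivity) hNV hNC hE1'' hET'' hδSinv
  have hW3 := hasMaj_mul_mul_transpose_exp (g := unitTorusGeo L k M) (liftBlk (fun b : Tor (fine n M) × Fin (d + 1) => blockOf n M b.1) ι) (liftBlk (fun y : Tor M => y) ι)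
    htri hd hsymm hrow hs (by linarith : s ≤ δ) (by positivity) (by positivity) (by positivity) hNV hNC hE1 hδE hS1
  -- assemble at the rate `δ/2 ≤ δ − 3s`
  rw [landauCov_sub_factorised, Matrix.mulVecLin_add, Matrix.mulVecLin_add]
  have hW1' := hW1.of_rate_le hd (by positivity) (by linarith : δ / 2 ≤ δ - s)
  have hW2' := hW2.of_rate_le hd (by positivity) (by linarith : δ / 2 ≤ δ - 2 * s - s)
  have hW3' := hW3.of_rate_le hd (by positivity) (by linarith : δ / 2 ≤ δ - s)
  refine ((hW1'.add hW2').add hW3').mono fun y y' => le_of_eq ?_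
  simp only [landauLetterConst]
  push_cast
  field_simp
  ring

end Letter

end Summit.QuantumFields.YangMills.BalabanUVNodes.N15.CovLandau

end
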